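import Summits.BirchSwinnertonDyer.BirchSwinnertonDyer.Theorems.UniversalToricDescentTwinFramesAtThreeOfTresSelfDual
import HarnessLib

/-!
# SKELETON PROPOSAL v17T (line `membertower`, crux ♭B′° `TwinDegreeFrameAtThreeMultTresT` = stmt-BirchSwinnertonDyer-22539 ONLY;
# width seat bsd-wall-utd-b-w1 g2, 2026-08-29) — the T2-PROOF form of g0's v17: research stub := K1♯†_T (= item 23310's text AFTER the pen's
# restatement T2, i.e. rev-78 text + the très-ramifié binder), composition keyed on TEXTS only; NOT registered here (crux LEAD's call)

v17T = v16 (LEAD utd-p2 g18, 8c09f9fed2825b17) MINUS `stub_thmB` (PUB 20711; not needed for the DEGREE clause, p680907), with the research stub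
spelled as K1♯†_T — item 23310 `TwinSelfDualMemberRationalInclusionAtThree` with ONE binder `¬ 3 ∣ padicValInt 3 W'.minimalDiscriminantInt →`
inserted after `Odd (NumberField.discr K) →` (fully qualified; = the post-T2 item text if the pen files B-COLUMN-TRES-NOTE §3 / T1-RESTATE-ROBUST §3
verbatim). Unlike g0's v17 (`Lines/membertower_v17_noThmB_proposal.lean`, whose composition p680907 §2 reads item 23310 BY NAME and whose stub
carries the PRE-T2 text — it stops elaborating at T2), this file reads NO route decl of the B column by name except the crux it concludes, so it
elaborates before AND after T2. Two stubs:

* `stub_pubMembersFramesCongruence` := `Castella2018.castella2020_thm211_members_frames_sigma_congruence_odd_nonsplit_wt` (item 23284, PUB BY NAME) — v16 VERBATIM.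
* `stub_tresSelfDualMemberRationalInclusionAtThree` := K1♯†_T (RESEARCH; after T2 = item 23310's successor VERBATIM; closable from TV₃† by ONE name,
  p682284 §2 `tresSelfDual_of_twoVarCoreAtThreeDagger`).

Composition: `TwinDegreeFrameAtThreeMultTresT_of` := p682999 §4
`UniversalToricDescentTwinFramesAtThreeOfTresSelfDual.twinDegreeFrameAtThreeMultTresT_of_allSplitWtMembersFrames_of_tresSelfDual` ∘ (4)† §2
`allSplitWtMembersFrames_of_nonsplitWtMembersFrames`. lean rc 0 expected with exactly 2 sorries (the stubs); the crux concluded BY NAME.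
Alternative with the research stub keyed by the road's name: `Lines/membertower_v17tv_proposal.lean` (stub := TV₃†, composition p682999 §5).
BSD is not proved by any of this; every `sorry` below is a stub.
[cite: Castella2020JIMJ, Thm. 2.11] [cite: Castella2018Erratum, §2 (p. 2), Lemma 2.1, proof of Thm. 1.1 (a)(b)(c)] [cite: Skinner2016PacificMC, §2.6 (2-6-1), §3.1]
-/

noncomputable section

open scoped Classical

set_option linter.dupNamespace false
set_option autoImplicit false

namespace Summit.BirchSwinnertonDyer.BirchSwinnertonDyer.Cruxes.TwinDegreeFrameAtThreeMultTresT.MemberTower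

open PowerSeries WeierstrassCurve NumberField IsDedekindDomain Field
  Literature.NumberTheory.EllipticCurves
  Literature.NumberTheory.EllipticCurves.ModularForms
  Literature.NumberTheory.EllipticCurves.Rank1Residual
  Literature.NumberTheory.EllipticCurves.BigGaloisRep
  Literature.NumberTheory.EllipticCurves.GreenbergSelmer
  Literature.NumberTheory.GaloisRepresentations
  Summit.BirchSwinnertonDyer.Rank1Residual.X11b
  Summit.BirchSwinnertonDyer.Rank1Residual.X11b.Halves
  Summit.BirchSwinnertonDyer.BirchSwinnertonDyer.Theorems.SchneiderFree
  Summit.BirchSwinnertonDyer.BirchSwinnertonDyer.Theorems.UniversalToricDescentTwinWanFrameAtThreeMultTresTAllSplitSelfDual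
  Summit.BirchSwinnertonDyer.BirchSwinnertonDyer.Theorems.UniversalToricDescentTwinSelfDualMemberRationalInclusionAtThreeTres
  Summit.BirchSwinnertonDyer.BirchSwinnertonDyer.Theorems.UniversalToricDescentTwinFramesAtThreeOfTresSelfDual
  Summit.BirchSwinnertonDyer.BirchSwinnertonDyer.Theses.UniversalToricDescent
  Summit.BirchSwinnertonDyer.BirchSwinnertonDyer.Theorems

/-- STUB (BY NAME = item stmt-BirchSwinnertonDyer-23284 `TwinCastellaMembersFramesCongruenceOddInput` at route rev 72, the
weight-sharpened supply 22593†; PUBLISHED by reading; closes only by formalisation): Castella JIMJ 2020 §2 Def. 2.10 / Thm. 2.11 at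
an odd prime WITH the erratum's hypothesis (iii), members chosen with `2(p−1)p^{m−1} ∣ k_m − 2` (free in print: Skinner 2016 §2.6).
[cite: Castella2020JIMJ, §2 Def. 2.10, Thm. 2.11] [cite: Castella2018Erratum, Thm. 1.1 (iii), proof (a)(b)] [cite: Skinner2016PacificMC, §2.6 (2-6-1), §3.1] -/
theorem stub_pubMembersFramesCongruence :
    Castella2018.castella2020_thm211_members_frames_sigma_congruence_odd_nonsplit_wt := by
  sorry

/-- STUB (RESEARCH, hardest stub) **K1♯†_T** = item 23310 `TwinSelfDualMemberRationalInclusionAtThree` ON THE TRÈS-RAMIFIÉ LOCUS: its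
rev-78 text with the binder `¬ 3 ∣ padicValInt 3 W'.minimalDiscriminantInt →` after `Odd (NumberField.discr K) →` (fully qualified, 3059 ch; = the
post-T2 item text). For every twin `W′` multiplicative and très ramifié at `3` with `ρ̄₃` onto, all-split Heegner `K` of odd discriminant,
anticyclotomic `κ`, degree-one `𝔭 ∣ 3` with other slot `𝔭′`, branch-compatible `ι′`: for every depth `m ≥ 1`, every Hida member `D` with
`2(3−1)3^{m−1} ∣ k_m − 2` and `ρ̄` irreducible, `ι′`-compatible, every characterised receptacle `b`, every Σ-frame `(Ω_K ≠ 0, Ω_p ∈ 𝓞_{ℂ₃}ˣ, Q)`: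
`X^Σ_ac(A†_{g_m}; 𝔭′)` torsion ⟹ `∃ e, (3^e)·Ch(X^Σ_ac(A†_{g_m}))·𝓞_{ℂ₃}⟦T⟧ ⊆ (Q)` on the SELF-DUAL Tate twist. Closable by ONE name from TV₃†
(p682284 §2). No printed engine at `p = 3`. [cite: Castella2018Erratum, §2 (p. 2), (2.5)] [cite: JetchevSkinnerWan2017, §3.4, Cor. 3.4.2]
[cite: SkinnerUrban2014, Thm. 3.26, Prop. 3.23] -/
theorem stub_tresSelfDualMemberRationalInclusionAtThree :
  ∀ (W' : WeierstrassCurve ℚ) [W'.IsElliptic] [W'.IsGloballyMinimal] (N' : ℕ) [NeZero N'] (K : Type) [Field K] [NumberField K] (Dt' : Literature.NumberTheory.EllipticCurves.ModularForms.ModularParametrizationData W' N'), Literature.NumberTheory.EllipticCurves.Rank1Residual.Mult W' 3 → W'.HasSurjectiveModNGaloisRep 3 → W'.conductorNorm ℤ = N' → Literature.NumberTheory.EllipticCurves.IsImaginaryQuadratic K → Literature.NumberTheory.EllipticCurves.SatisfiesHeegnerHypothesis N' K → Odd (NumberField.discr K) → ¬ 3 ∣ padicValInt 3 W'.minimalDiscriminantInt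 → ∀ (κ : Literature.NumberTheory.EllipticCurves.ZpExtension K 3), κ.IsAnticyclotomic → ∀ (γ : Field.absoluteGaloisGroup K) [Fact (κ.IsTopGenerator γ)] (𝔭 : IsDedekindDomain.HeightOneSpectrum (NumberField.RingOfIntegers K)), ((3 : ℕ) : NumberField.RingOfIntegers K) ∈ 𝔭.asIdeal → 𝔭.asIdeal.ramificationIdx (NumberField.RingOfIntegers ℚ) = 1 → 𝔭.asIdeal.inertiaDeg (NumberField.RingOfIntegers ℚ) = 1 → ∀ (𝔭' : IsDedekindDomain.HeightOneSpectrum (NumberField.RingOfIntegers K)), ((3 : ℕ) : NumberField.RingOfIntegers K) ∈ 𝔭'.asIdeal → 𝔭' ≠ 𝔭 → ∀ (ι' : PadicAlgCl 3 ≃+* ℂ), Summit.BirchSwinnertonDyer.BirchSwinnertonDyer.Theorems.SchneiderFree.BranchInducesPrime 3 ι' 𝔭 → ∀ (m : ℕ), 1 ≤ m → ∀ (D : Literature.NumberTheory.EllipticCurves.Skinner2016.HidaCongruentMember W' 3 m), (2 * (((3 : ℕ) : ℤ) - 1) * ((3 : ℕ) : ℤ) ^ (m - 1)) ∣ D.k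 - 2 → Literature.NumberTheory.EllipticCurves.SkinnerUrban2014.IsResiduallyIrreducible D.Δ → (∀ x : Literature.NumberTheory.EllipticCurves.ModularForms.coeffField D.g, ι' (D.ι x) = (x : ℂ)) → ∀ (b : Literature.NumberTheory.EllipticCurves.GreenbergSelmer.padicCoeffIntegers D.ι →+* 𝓞_ℂ_[3]), (∀ x, ((b x : 𝓞_ℂ_[3]) : ℂ_[3]) = algebraMap (PadicAlgCl 3) ℂ_[3] (Literature.NumberTheory.EllipticCurves.GreenbergSelmer.padicCoeffIntegers.toPadicAlgCl D.ι x)) → ∀ (ΩK : ℂ) (Ωp : (𝓞_ℂ_[3])ˣ) (Q : PowerSeries 𝓞_ℂ_[3]), ΩK ≠ 0 → Literature.NumberTheory.EllipticCurves.IsBDPLFunctionWtSigmaInt ι' 𝔭 κ γ D.g (W'.sigmaPlacesFinset 3 K) ΩK ((Ωp : 𝓞_ℂ_[3]) : ℂ_[3]) Q → ∀ [TopologicalSpace (PowerSeries (Literature.NumberTheory.EllipticCurves.GreenbergSelmer.padicCoeffIntegers D.ι))] [ContinuousSMul (PowerSeries (Literature.NumberTheory.EllipticCurves.GreenbergSelmer.padicCoeffIntegers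 D.ι)) (Literature.NumberTheory.EllipticCurves.BigRepModule (Literature.NumberTheory.EllipticCurves.GreenbergSelmer.padicCoeffIntegers D.ι) 3 (Literature.NumberTheory.EllipticCurves.GreenbergSelmer.Cofree D.Δ.selfDualRep (Literature.NumberTheory.EllipticCurves.GreenbergSelmer.padicCoeffField D.ι)))], Module.IsTorsion (PowerSeries (Literature.NumberTheory.EllipticCurves.GreenbergSelmer.padicCoeffIntegers D.ι)) (Literature.NumberTheory.EllipticCurves.BigGaloisRep.XBig κ (D.Δ.selfDualCofreeRepOver K) 𝔭' (↑(W'.sigmaPlacesFinset 3 K))) → ∃ e : ℕ, Ideal.span {(PowerSeries.C ((3 : ℕ) : 𝓞_ℂ_[3]) : PowerSeries 𝓞_ℂ_[3]) ^ e} * (Literature.NumberTheory.EllipticCurves.BigGaloisRep.XBig.charIdeal κ (D.Δ.selfDualCofreeRepOver K) 𝔭' (↑(W'.sigmaPlacesFinset 3 K))).map (PowerSeries.map b) ≤ Ideal.span {Q} := by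
  sorry

/-- COMPOSITION (v17T, act DEG): ♭B′° `TwinDegreeFrameAtThreeMultTresT` (item stmt-BirchSwinnertonDyer-22539) BY NAME from the TWO stubs through
p682999 §4 ∘ (4)† §2 (supply frame from the fact†, (dec) from the très-ramifié binder, `μ(L) = 0` from the degree clause's own profile hypothesis,
self-dual member tower with inclusions from K1♯†_T, `degreeClause_of_wanClause`). [folklore] -/
theorem TwinDegreeFrameAtThreeMultTresT_of :
    Summit.BirchSwinnertonDyer.BirchSwinnertonDyer.Theses.UniversalToricDescent.TwinDegreeFrameAtThreeMultTresT :=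
  Summit.BirchSwinnertonDyer.BirchSwinnertonDyer.Theorems.UniversalToricDescentTwinFramesAtThreeOfTresSelfDual.twinDegreeFrameAtThreeMultTresT_of_allSplitWtMembersFrames_of_tresSelfDual
    (Summit.BirchSwinnertonDyer.BirchSwinnertonDyer.Theorems.UniversalToricDescentTwinWanFrameAtThreeMultTresTAllSplitSelfDual.allSplitWtMembersFrames_of_nonsplitWtMembersFrames
      stub_pubMembersFramesCongruence)
    stub_tresSelfDualMemberRationalInclusionAtThree

end Summit.BirchSwinnertonDyer.BirchSwinnertonDyer.Cruxes.TwinDegreeFrameAtThreeMultTresT.MemberTower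

end
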